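import Summits.BirchSwinnertonDyer.BirchSwinnertonDyer.Theorems.SignedLowerHalvesSmallImageLowerHalfBothSignsRttCharRoadE2JunctionIndex
import Summits.BirchSwinnertonDyer.BirchSwinnertonDyer.Theorems.SignedLowerHalvesSmallImageLowerHalfBothSignsRttCharRoadE2JunctionChi
import HarnessLib

/-!
# Route `SignedLowerHalves`, crux L `SmallImageLowerHalfBothSigns` (stmt-BirchSwinnertonDyer-23599), line `rtt_w3` v13 — E2, row (6′) E2-K JUNCTION, LEAD:
# THE JUNCTION ASSEMBLY — `λ(H ⧸ Λ_𝒪∙z) + λ(ker j) = λ(H' ⧸ Λ_𝒪∙z') + λ(B ⧸ s(H'))` for `H' ↪ˢ B ↠ʲ H`, and the glue's `hK` from it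

WHY (BRIEF-E2 rev 3.2 §2 steps 1–2–5, `Lines/rtt_w3-BRIEF-E2-g9c.md`). The E2-K junction map is `eH = j ∘ sp¹ : Hsp ↪ 𝐇¹_Σ(K^cyc_∞, T*) ↠ ker gX`
(`sp¹` the specialisation injection with `coker sp¹ ↪ H²₂[f]`; `j = π ∘ loc_v` SURJECTIVE onto `ker gX` by Poitou–Tate, `ker j = 𝐒` the compact Selmer
group). Adding the index identity p777767 (`λ(H ⧸ ∙z) + λ(ker eH) = λ(H' ⧸ ∙z') + λ(coker eH)`) to the composite index p777820
(`λ(coker (j∘s)) + λ(ker j) = λ(coker s) + λ(ker (j∘s))`) the `eH`-terms cancel: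
* ★★ `lambdaInvariant_quotient_span_add_ker_eq_of_junction`: `λ(H ⧸ Λ_𝒪∙z) + λ(ker j) = λ(H' ⧸ Λ_𝒪∙z') + λ(B ⧸ range s)` for `Λ_𝒪`-linear `s : H' → B` injective,
  `j : B → H` surjective, `z = j (s z')` with `l•z = 0 ⇒ l•z' = 0`, and f.g.-torsion (over `Λ`) of `H' ⧸ ∙z'`, `H ⧸ ∙z`, `B ⧸ range s`, `ker j`;
* ★★★ `lambdaInvariant_quotient_span_le_of_junction`: hence `λ(B ⧸ range s) ≤ m` and `λ(H' ⧸ Λ_𝒪∙z') + m ≤ λ(Y)` (road D in EQUALITY form with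
  `m = λ(H²₂[f])`, LEAD `…RttD2SpecialisationHKEq`, and `λ(Ysp) ≤ λ(Y)`) give the glue's `hK : λ(H ⧸ Λ_𝒪∙z) ≤ λ(Y)` (`H := ker gX`, `Y := coker gX` in
  `charRoad_E2_of_localisation`) — NO finiteness of `coker eH`, NO vanishing of `𝐒`, NO pseudo-null input.
THEOREMS ONLY (kernel commutative algebra; `--supports stmt-BirchSwinnertonDyer-23599` helper); the junction DATA (`s`, `j`, the two inequalities) are the
research content of rows (6′a)(6′b)(6′d) and are HYPOTHESES here; crux L, crux M, E2 and BSD remain OPEN and are proved for NO curve by any of this.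
[cite: Washington1997, §13.2] [cite: Kobayashi2003, Thm. 7.3 i)] [folklore]
-/

set_option linter.dupNamespace false -- D-0017: single-problem summit, the namespace repeats the problem name by design
set_option autoImplicit false

noncomputable section

namespace Summit.BirchSwinnertonDyer.BirchSwinnertonDyer.Theorems.SmallImageRttCharRoad

open Literature.NumberTheory.EllipticCurves

universe u v w

variable {p : ℕ} [Fact p.Prime] {S : Set (PadicAlgCl p)} [Algebra (IwasawaAlgebra p) (IwasawaAlgebraO S)]
  {H' : Type u} {B : Type v} {H : Type w}
  [AddCommGroup H'] [Module (IwasawaAlgebraO S) H'] [Module (IwasawaAlgebra p) H'] [IsScalarTower (IwasawaAlgebra p) (IwasawaAlgebraO S) H']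
  [AddCommGroup B] [Module (IwasawaAlgebraO S) B] [Module (IwasawaAlgebra p) B] [IsScalarTower (IwasawaAlgebra p) (IwasawaAlgebraO S) B]
  [AddCommGroup H] [Module (IwasawaAlgebraO S) H] [Module (IwasawaAlgebra p) H] [IsScalarTower (IwasawaAlgebra p) (IwasawaAlgebraO S) H]

/-- The kernel of the `Λ`-restriction of a `Λ_𝒪`-linear map IS its kernel, as `Λ`-modules (bookkeeping equivalence; a theorem, not a definition,
to stay in the proof lane). [folklore] -/
theorem nonempty_ker_restrictScalars_linearEquiv_ker (j : B →ₗ[IwasawaAlgebraO S] H) :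
    Nonempty (LinearMap.ker (j.restrictScalars (IwasawaAlgebra p)) ≃ₗ[IwasawaAlgebra p] LinearMap.ker j) :=
  ⟨{ toFun := fun x ↦ ⟨x, by have h := x.2; rwa [LinearMap.mem_ker, LinearMap.restrictScalars_apply] at h⟩
     invFun := fun x ↦ ⟨x, by rw [LinearMap.mem_ker, LinearMap.restrictScalars_apply]; exact x.2⟩
     map_add' := fun _ _ ↦ rfl
     map_smul' := fun _ _ ↦ rfl
     left_inv := fun _ ↦ rfl
     right_inv := fun _ ↦ rfl }⟩

/-- The quotient by the `Λ`-restricted range of a `Λ_𝒪`-linear map IS the quotient by its range, as `Λ`-modules (bookkeeping equivalence). [folklore] -/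
theorem nonempty_quotient_range_restrictScalars_linearEquiv (s : H' →ₗ[IwasawaAlgebraO S] B) :
    Nonempty ((B ⧸ LinearMap.range (s.restrictScalars (IwasawaAlgebra p))) ≃ₗ[IwasawaAlgebra p] (B ⧸ LinearMap.range s)) :=
  ⟨(Submodule.quotEquivOfEq _ _ (LinearMap.range_restrictScalars s)).trans
    (Submodule.Quotient.restrictScalarsEquiv (IwasawaAlgebra p) (LinearMap.range s))⟩

/-- ★★ **The junction assembly (index form).** `Λ_𝒪`-modules `H', B, H` with scalar-tower `Λ`-structures; `s : H' → B` `Λ_𝒪`-linear INJECTIVE, `j : B → H`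
`Λ_𝒪`-linear SURJECTIVE; `z' ∈ H'`, `z = j (s z')` with `l • z = 0 ⇒ l • z' = 0` (e.g. `z` non-torsion); `H' ⧸ Λ_𝒪∙z'`, `H ⧸ Λ_𝒪∙z`, `B ⧸ range s` and `ker j`
finitely generated torsion over `Λ`. Then `λ(H ⧸ Λ_𝒪∙z) + λ(ker j) = λ(H' ⧸ Λ_𝒪∙z') + λ(B ⧸ range s)`. (Index identity p777767 for `eH = j ∘ s` plus composite
index p777820; the terms `λ(ker eH)`, `λ(coker eH)` cancel.) In E2: `H' = Hsp`, `z' = ζ̄`, `B = 𝐇¹_Σ(K^cyc_∞, T*)`, `s = sp¹`, `j = π ∘ loc_v`, `H = ker gX`,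
`ker j = 𝐒`. [cite: Washington1997, §13.2] [folklore] -/
theorem lambdaInvariant_quotient_span_add_ker_eq_of_junction (s : H' →ₗ[IwasawaAlgebraO S] B) (hs : Function.Injective s)
    (j : B →ₗ[IwasawaAlgebraO S] H) (hj : Function.Surjective j) (z' : H') (z : H) (hz : j (s z') = z)
    (hmeet : ∀ l : IwasawaAlgebraO S, l • z = 0 → l • z' = 0)
    [Module.Finite (IwasawaAlgebra p) (H' ⧸ Submodule.span (IwasawaAlgebraO S) {z'})]
    (ht' : Module.IsTorsion (IwasawaAlgebra p) (H' ⧸ Submodule.span (IwasawaAlgebraO S) {z'}))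
    [Module.Finite (IwasawaAlgebra p) (H ⧸ Submodule.span (IwasawaAlgebraO S) {z})]
    (ht : Module.IsTorsion (IwasawaAlgebra p) (H ⧸ Submodule.span (IwasawaAlgebraO S) {z}))
    [Module.Finite (IwasawaAlgebra p) (B ⧸ LinearMap.range s)] (htB : Module.IsTorsion (IwasawaAlgebra p) (B ⧸ LinearMap.range s))
    [Module.Finite (IwasawaAlgebra p) (LinearMap.ker j)] (htj : Module.IsTorsion (IwasawaAlgebra p) (LinearMap.ker j)) :
    lambdaInvariant p (H ⧸ Submodule.span (IwasawaAlgebraO S) {z}) + lambdaInvariant p (LinearMap.ker j) =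
      lambdaInvariant p (H' ⧸ Submodule.span (IwasawaAlgebraO S) {z'}) + lambdaInvariant p (B ⧸ LinearMap.range s) := by
  -- the index identity for `eH = j ∘ s`
  have h1 := lambdaInvariant_quotient_span_add_ker_eq (j ∘ₗ s) z' z (by rw [LinearMap.comp_apply, hz]) hmeet ht' ht
  -- the composite index for `j ∘ s`, over `Λ`
  let sΛ := s.restrictScalars (IwasawaAlgebra p)
  let jΛ := j.restrictScalars (IwasawaAlgebra p)
  have hcomp : jΛ ∘ₗ sΛ = (j ∘ₗ s).restrictScalars (IwasawaAlgebra p) := LinearMap.ext fun _ ↦ rfl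
  obtain ⟨eQs⟩ := nonempty_quotient_range_restrictScalars_linearEquiv (p := p) s
  obtain ⟨eQjs⟩ := nonempty_quotient_range_restrictScalars_linearEquiv (p := p) (j ∘ₗ s)
  obtain ⟨eKj⟩ := nonempty_ker_restrictScalars_linearEquiv_ker (p := p) j
  haveI : Module.Finite (IwasawaAlgebra p) (B ⧸ LinearMap.range sΛ) := Module.Finite.equiv eQs.symm
  have htB' : Module.IsTorsion (IwasawaAlgebra p) (B ⧸ LinearMap.range sΛ) := isTorsion_of_linearEquiv eQs.symm htB
  haveI : Module.Finite (IwasawaAlgebra p) (LinearMap.ker jΛ) := Module.Finite.equiv eKj.symm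
  have htj' : Module.IsTorsion (IwasawaAlgebra p) (LinearMap.ker jΛ) := isTorsion_of_linearEquiv eKj.symm htj
  have h2 := lambdaInvariant_coker_comp_add_ker_eq sΛ hs jΛ hj htB' htj'
  rw [hcomp] at h2
  -- identify the common terms
  have e1 : lambdaInvariant p (H ⧸ LinearMap.range ((j ∘ₗ s).restrictScalars (IwasawaAlgebra p))) = lambdaInvariant p (H ⧸ LinearMap.range (j ∘ₗ s)) :=
    lambdaInvariant_eq_of_linearEquiv eQjs
  have e2 : lambdaInvariant p (LinearMap.ker jΛ) = lambdaInvariant p (LinearMap.ker j) := lambdaInvariant_eq_of_linearEquiv eKj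
  have e3 : lambdaInvariant p (B ⧸ LinearMap.range sΛ) = lambdaInvariant p (B ⧸ LinearMap.range s) := lambdaInvariant_eq_of_linearEquiv eQs
  rw [e1, e2, e3] at h2
  omega

/-- ★★★ **The glue's `hK` from the junction.** In the setting of `lambdaInvariant_quotient_span_add_ker_eq_of_junction`, if `λ(B ⧸ range s) ≤ m` (in E2:
`coker sp¹ ↪ H²₂[f]`, `m = λ(H²₂[f])`) and `λ(H' ⧸ Λ_𝒪∙z') + m ≤ λ(Y)` (road D in EQUALITY form `λ(Hsp ⧸ ∙ζ̄) + λ(H²₂[f]) = λ(Ysp)`, LEAD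
`SmallImageRttD2LamSpec.lambdaInvariant_quotSMulTop_add_torsionBy_eq_of_thm52Shape_of_torsionBy_eq_bot`, followed by `λ(Ysp) ≤ λ(Y)`), then
`λ(H ⧸ Λ_𝒪∙z) ≤ λ(Y)` — the binder `hK` of `charRoad_E2_of_localisation` for `H := ker gX`, `Y := X' ⧸ range gX`. No finiteness of `coker (j ∘ s)`, no `𝐒 = 0`.
[cite: Washington1997, §13.2] [cite: Kobayashi2003, Thm. 7.3 i)] [folklore] -/
theorem lambdaInvariant_quotient_span_le_of_junction (s : H' →ₗ[IwasawaAlgebraO S] B) (hs : Function.Injective s)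
    (j : B →ₗ[IwasawaAlgebraO S] H) (hj : Function.Surjective j) (z' : H') (z : H) (hz : j (s z') = z)
    (hmeet : ∀ l : IwasawaAlgebraO S, l • z = 0 → l • z' = 0)
    [Module.Finite (IwasawaAlgebra p) (H' ⧸ Submodule.span (IwasawaAlgebraO S) {z'})]
    (ht' : Module.IsTorsion (IwasawaAlgebra p) (H' ⧸ Submodule.span (IwasawaAlgebraO S) {z'}))
    [Module.Finite (IwasawaAlgebra p) (H ⧸ Submodule.span (IwasawaAlgebraO S) {z})]
    (ht : Module.IsTorsion (IwasawaAlgebra p) (H ⧸ Submodule.span (IwasawaAlgebraO S) {z}))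
    [Module.Finite (IwasawaAlgebra p) (B ⧸ LinearMap.range s)] (htB : Module.IsTorsion (IwasawaAlgebra p) (B ⧸ LinearMap.range s))
    [Module.Finite (IwasawaAlgebra p) (LinearMap.ker j)] (htj : Module.IsTorsion (IwasawaAlgebra p) (LinearMap.ker j))
    {Y : Type*} [AddCommGroup Y] [Module (IwasawaAlgebra p) Y] (m : ℕ)
    (hcoker : lambdaInvariant p (B ⧸ LinearMap.range s) ≤ m)
    (hroadD : lambdaInvariant p (H' ⧸ Submodule.span (IwasawaAlgebraO S) {z'}) + m ≤ lambdaInvariant p Y) :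
    lambdaInvariant p (H ⧸ Submodule.span (IwasawaAlgebraO S) {z}) ≤ lambdaInvariant p Y := by
  have h := lambdaInvariant_quotient_span_add_ker_eq_of_junction s hs j hj z' z hz hmeet ht' ht htB htj
  omega

/-! ## One-sided form: no hypothesis on `ker j` (the compact Selmer group `𝐒`), `s` need not be injective -/

/-- ★★ **The junction inequality, one-sided.** `Λ_𝒪`-modules `H', B, H` with scalar-tower `Λ`-structures; `s : H' → B` `Λ_𝒪`-linear, `j : B → H` `Λ_𝒪`-linear
SURJECTIVE; `z = j (s z')` with `l • z = 0 ⇒ l • z' = 0`; `H' ⧸ Λ_𝒪∙z'`, `H ⧸ Λ_𝒪∙z` and `B ⧸ range s` finitely generated torsion over `Λ`. Then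
`λ(H ⧸ Λ_𝒪∙z) ≤ λ(H' ⧸ Λ_𝒪∙z') + λ(B ⧸ range s)`: the index identity p777767 for `eH = j ∘ s` gives `λ(H ⧸ ∙z) ≤ λ(H' ⧸ ∙z') + λ(H ⧸ range (j∘s))`, and `j`
induces `B ⧸ range s ↠ H ⧸ range (j ∘ s)`. NO hypothesis on `ker j` (in E2 the compact Selmer group `𝐒` — neither its vanishing nor its torsion-ness is used),
no injectivity of `s`. [cite: Washington1997, §13.2] [folklore] -/
theorem lambdaInvariant_quotient_span_le_add_of_junction (s : H' →ₗ[IwasawaAlgebraO S] B) (j : B →ₗ[IwasawaAlgebraO S] H)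
    (hj : Function.Surjective j) (z' : H') (z : H) (hz : j (s z') = z) (hmeet : ∀ l : IwasawaAlgebraO S, l • z = 0 → l • z' = 0)
    [Module.Finite (IwasawaAlgebra p) (H' ⧸ Submodule.span (IwasawaAlgebraO S) {z'})]
    (ht' : Module.IsTorsion (IwasawaAlgebra p) (H' ⧸ Submodule.span (IwasawaAlgebraO S) {z'}))
    [Module.Finite (IwasawaAlgebra p) (H ⧸ Submodule.span (IwasawaAlgebraO S) {z})]
    (ht : Module.IsTorsion (IwasawaAlgebra p) (H ⧸ Submodule.span (IwasawaAlgebraO S) {z}))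
    [Module.Finite (IwasawaAlgebra p) (B ⧸ LinearMap.range s)] (htB : Module.IsTorsion (IwasawaAlgebra p) (B ⧸ LinearMap.range s)) :
    lambdaInvariant p (H ⧸ Submodule.span (IwasawaAlgebraO S) {z}) ≤
      lambdaInvariant p (H' ⧸ Submodule.span (IwasawaAlgebraO S) {z'}) + lambdaInvariant p (B ⧸ LinearMap.range s) := by
  -- the index identity for `eH = j ∘ s`
  have h1 := lambdaInvariant_quotient_span_add_ker_eq (j ∘ₗ s) z' z (by rw [LinearMap.comp_apply, hz]) hmeet ht' ht
  -- `j` induces `B ⧸ range s ↠ H ⧸ range (j ∘ s)`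
  have hle : LinearMap.range s ≤ (LinearMap.range (j ∘ₗ s)).comap j := by
    rintro _ ⟨a, rfl⟩
    exact ⟨a, rfl⟩
  let π : (B ⧸ LinearMap.range s) →ₗ[IwasawaAlgebraO S] (H ⧸ LinearMap.range (j ∘ₗ s)) :=
    (LinearMap.range s).mapQ (LinearMap.range (j ∘ₗ s)) j hle
  have hπ : Function.Surjective (π.restrictScalars (IwasawaAlgebra p)) := by
    intro y
    induction y using Submodule.Quotient.induction_on with
    | H x =>
      obtain ⟨b, rfl⟩ := hj x
      exact ⟨Submodule.Quotient.mk b, rfl⟩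
  have h2 := Summit.BirchSwinnertonDyer.Rank1Residual.X2.DualRestrictionInvariants.lambdaInvariant_eq_add_of_surjective p
    (π.restrictScalars (IwasawaAlgebra p)) htB hπ
  omega

/-- ★★★ **The glue's `hK` from the junction, one-sided form** (supersedes `lambdaInvariant_quotient_span_le_of_junction` for the E2 use: no `ker j`
hypothesis, no injectivity of `s`). If moreover `λ(B ⧸ range s) ≤ m` (in E2: `coker sp¹ ↪ H²₂[f]`, `m = λ(H²₂[f])`) and `λ(H' ⧸ Λ_𝒪∙z') + m ≤ λ(Y)` (road D in
equality form, then `λ(Ysp) ≤ λ(Y)`), then `λ(H ⧸ Λ_𝒪∙z) ≤ λ(Y)` — the binder `hK` of `charRoad_E2_of_localisation` (`H := ker gX`, `Y := coker gX`).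
[cite: Washington1997, §13.2] [cite: Kobayashi2003, Thm. 7.3 i)] [folklore] -/
theorem lambdaInvariant_quotient_span_le_of_junction' (s : H' →ₗ[IwasawaAlgebraO S] B) (j : B →ₗ[IwasawaAlgebraO S] H)
    (hj : Function.Surjective j) (z' : H') (z : H) (hz : j (s z') = z) (hmeet : ∀ l : IwasawaAlgebraO S, l • z = 0 → l • z' = 0)
    [Module.Finite (IwasawaAlgebra p) (H' ⧸ Submodule.span (IwasawaAlgebraO S) {z'})]
    (ht' : Module.IsTorsion (IwasawaAlgebra p) (H' ⧸ Submodule.span (IwasawaAlgebraO S) {z'}))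
    [Module.Finite (IwasawaAlgebra p) (H ⧸ Submodule.span (IwasawaAlgebraO S) {z})]
    (ht : Module.IsTorsion (IwasawaAlgebra p) (H ⧸ Submodule.span (IwasawaAlgebraO S) {z}))
    [Module.Finite (IwasawaAlgebra p) (B ⧸ LinearMap.range s)] (htB : Module.IsTorsion (IwasawaAlgebra p) (B ⧸ LinearMap.range s))
    {Y : Type*} [AddCommGroup Y] [Module (IwasawaAlgebra p) Y] (m : ℕ)
    (hcoker : lambdaInvariant p (B ⧸ LinearMap.range s) ≤ m)
    (hroadD : lambdaInvariant p (H' ⧸ Submodule.span (IwasawaAlgebraO S) {z'}) + m ≤ lambdaInvariant p Y) :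
    lambdaInvariant p (H ⧸ Submodule.span (IwasawaAlgebraO S) {z}) ≤ lambdaInvariant p Y := by
  have h := lambdaInvariant_quotient_span_le_add_of_junction s j hj z' z hz hmeet ht' ht htB
  omega

end Summit.BirchSwinnertonDyer.BirchSwinnertonDyer.Theorems.SmallImageRttCharRoad

end
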